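import Literature.MathematicalPhysics.KineticTheory.HarmonicChaosDecomposition
import HarnessLib

/-!
# Stub K2 `stub_wickShellStatic`, part II: the thermal two-point function as a one-phonon integral
(line `gram-pencil-harmonic-chaos`, crux `EmbeddedDrudeMourre.DrudeDissolution`,
item stmt-AtomisticToContinuum-12593; `--supports` file, closes nothing; lead c11)

WHAT. The thermal covariance of two linear observables of the harmonic chain, the second translated by
`y` lattice units, is twice the real part of a Fourier coefficient of the product of their thermal
one-phonon wave functions (`HarmonicChaos.thermalWave`, `w_f(k) = √(T/2) Σ_x e^{ikx}(f^q_x/ω(k) − i f^p_x)`):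

  `C_T(f, τ_y g) = 2 Re ∫_𝕋 e^{iky} conj(w_f(k)) w_g(k) dμ𝕋(k)`   (`thermalCov_shift_eq_two_mul_re`),

where `τ_y g` has coefficients `g_{· − y}` (`Finsupp.mapDomain (· + y)`). Ingredients: `∫ e_n dμ𝕋 = [n = 0]`
(orthonormality of the Fourier monomials), the lattice Green function as the real part of a complex Fourier
integral (`greenFn ω₂ z = Re ∫ e_z ω⁻² dμ𝕋`), evenness of `greenFn`, and the vanishing of the imaginary part
of `∫ e_z ω⁻¹ dμ𝕋` (`ω` is even, the Haar measure is reflection invariant), which kills the `q–p` cross terms.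
-/

noncomputable section

namespace Summit.AtomisticToContinuum.FouriersLaw.Theorems.DrudeDissolution.GramPencilHarmonicChaos

open MeasureTheory Filter Set Function Topology
open scoped InnerProductSpace ENNReal ComplexConjugate
open Literature.MathematicalPhysics.KineticTheory
open Literature.MathematicalPhysics.KineticTheory.HeatConduction
open HarmonicChaos ProbabilityTheory
open PinnedChainKinetic (𝕋 𝕋3 μ𝕋 μ𝕋3)
open scoped Literature.MathematicalPhysics.KineticTheory.HeatConduction.PinnedChainKinetic

/-! ## Fourier monomials on the Brillouin zone -/

/-- `e_n(−k) = conj e_n(k)`. [folklore] -/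
theorem fourier_apply_neg (n : ℤ) (k : 𝕋) : fourier n (-k) = conj (fourier n k) := by
  rw [fourier_apply, smul_neg]
  exact fourier_neg'

/-- `conj e_n(k) = e_{−n}(k)`. [folklore] -/
theorem conj_fourier (n : ℤ) (k : 𝕋) : conj (fourier n k) = fourier (-n) k :=
  fourier_neg.symm

/-- **Orthonormality of the Fourier monomials**: `∫ e_n dμ𝕋 = [n = 0]`. [folklore] -/
theorem integral_fourier (n : ℤ) : ∫ k : 𝕋, fourier n k ∂μ𝕋 = if n = 0 then 1 else 0 := by
  have h := congrFun (fourierCoeff_fourier (T := 2 * Real.pi) n) 0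
  rw [Pi.single_apply] at h
  unfold fourierCoeff at h
  simp only [neg_zero, fourier_zero, one_smul] at h
  rw [h]
  by_cases hn : n = 0
  · simp [hn]
  · simp [hn, Ne.symm hn]

/-- Continuous complex functions on the Brillouin zone are integrable for `μ𝕋`. [folklore] -/
theorem integrable_of_continuous_circle {F : 𝕋 → ℂ} (hF : Continuous F) : Integrable F μ𝕋 :=
  (memLp_two_of_continuous_circle hF).integrable one_le_two

/-- Continuity of `e_z / ω`. [folklore] -/
theorem continuous_fourier_div_dispersion {ω₂ : ℝ} (hω : 0 < ω₂) (z : ℤ) :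
    Continuous fun k : 𝕋 => fourier z k / (PinnedChainKinetic.dispersion ω₂ k : ℂ) :=
  (fourier z).continuous.div (Complex.continuous_ofReal.comp (PinnedChainKinetic.continuous_dispersion ω₂))
    (fun k => Complex.ofReal_ne_zero.2 (PinnedChainKinetic.dispersion_ne_zero hω k))

/-- Continuity of `e_z / ω²`. [folklore] -/
theorem continuous_fourier_div_dispersion_sq {ω₂ : ℝ} (hω : 0 < ω₂) (z : ℤ) :
    Continuous fun k : 𝕋 => fourier z k / (PinnedChainKinetic.dispersion ω₂ k : ℂ) ^ 2 :=
  (fourier z).continuous.div ((Complex.continuous_ofReal.comp (PinnedChainKinetic.continuous_dispersion ω₂)).pow 2)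
    (fun k => pow_ne_zero 2 (Complex.ofReal_ne_zero.2 (PinnedChainKinetic.dispersion_ne_zero hω k)))

/-- **The lattice Green function as a complex Fourier integral**: `G(z) = Re ∫ e_z ω⁻² dμ𝕋`. [folklore] -/
theorem greenFn_eq_re_integral {ω₂ : ℝ} (hω : 0 < ω₂) (z : ℤ) :
    greenFn ω₂ z = (∫ k : 𝕋, fourier z k / (PinnedChainKinetic.dispersion ω₂ k : ℂ) ^ 2 ∂μ𝕋).re := by
  unfold greenFn
  have hint := integrable_of_continuous_circle (continuous_fourier_div_dispersion_sq hω z)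
  have h := integral_re hint
  rw [RCLike.re_eq_complex_re] at h
  rw [← h]
  refine integral_congr_ae (ae_of_all _ fun k => ?_)
  show ((fourier z) k).re / PinnedChainKinetic.dispersion ω₂ k ^ 2 =
    RCLike.re ((fourier z) k / (PinnedChainKinetic.dispersion ω₂ k : ℂ) ^ 2)
  rw [RCLike.re_eq_complex_re, ← Complex.ofReal_pow, Complex.div_ofReal_re]

/-- `G` is even: `G(−z) = G(z)`. [folklore] -/
theorem greenFn_neg (ω₂ : ℝ) (z : ℤ) : greenFn ω₂ (-z) = greenFn ω₂ z := by
  unfold greenFn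
  refine integral_congr_ae (ae_of_all _ fun k => ?_)
  simp only
  rw [← conj_fourier, Complex.conj_re]

/-- **The imaginary part of `∫ e_z ω⁻¹ dμ𝕋` vanishes** (`ω` is even and the Haar measure of the circle is
reflection invariant). [folklore] -/
theorem im_integral_fourier_div_dispersion (ω₂ : ℝ) (z : ℤ) :
    (∫ k : 𝕋, fourier z k / (PinnedChainKinetic.dispersion ω₂ k : ℂ) ∂μ𝕋).im = 0 := by
  set F : 𝕋 → ℂ := fun k => fourier z k / (PinnedChainKinetic.dispersion ω₂ k : ℂ) with hF
  have h1 : ∫ k, F k ∂μ𝕋 = ∫ k, F (-k) ∂μ𝕋 :=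
    (measurePreserving_neg_circle.integral_comp (MeasurableEquiv.neg 𝕋).measurableEmbedding F).symm
  have h2 : ∀ k, F (-k) = conj (F k) := fun k => by
    simp only [hF, fourier_apply_neg, PinnedChainKinetic.dispersion_neg, map_div₀, Complex.conj_ofReal]
  simp_rw [h2] at h1
  rw [integral_conj] at h1
  exact Complex.conj_eq_iff_im.1 h1.symm

/-- **The elementary two-point integral** (one pair of sites): for real `α, β, γ, δ` and `z ∈ ℤ`,
`Re ∫ e_z (α/ω + iβ)(γ/ω − iδ) dμ𝕋 = αγ G(z) + βδ [z = 0]`. [folklore] -/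
theorem re_integral_pair {ω₂ : ℝ} (hω : 0 < ω₂) (α β γ δ : ℝ) (z : ℤ) :
    (∫ k : 𝕋, fourier z k * (((α : ℂ) / (PinnedChainKinetic.dispersion ω₂ k : ℂ) + Complex.I * β) *
        ((γ : ℂ) / (PinnedChainKinetic.dispersion ω₂ k : ℂ) - Complex.I * δ)) ∂μ𝕋).re =
      α * γ * greenFn ω₂ z + β * δ * (if z = 0 then 1 else 0) := by
  have hne : ∀ k : 𝕋, (PinnedChainKinetic.dispersion ω₂ k : ℂ) ≠ 0 := fun k =>
    Complex.ofReal_ne_zero.2 (PinnedChainKinetic.dispersion_ne_zero hω k)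
  -- split the integrand
  have hsplit : ∀ k : 𝕋,
      fourier z k * (((α : ℂ) / (PinnedChainKinetic.dispersion ω₂ k : ℂ) + Complex.I * β) *
        ((γ : ℂ) / (PinnedChainKinetic.dispersion ω₂ k : ℂ) - Complex.I * δ)) =
      ((α * γ : ℝ) : ℂ) * (fourier z k / (PinnedChainKinetic.dispersion ω₂ k : ℂ) ^ 2) +
        ((β * δ : ℝ) : ℂ) * fourier z k +
        (Complex.I * ((β * γ - α * δ : ℝ) : ℂ)) * (fourier z k / (PinnedChainKinetic.dispersion ω₂ k : ℂ)) := by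
    intro k
    have h := hne k
    field_simp
    push_cast
    ring_nf
    rw [Complex.I_sq]
    ring
  simp_rw [hsplit]
  have i1 : Integrable (fun k : 𝕋 => ((α * γ : ℝ) : ℂ) *
      (fourier z k / (PinnedChainKinetic.dispersion ω₂ k : ℂ) ^ 2)) μ𝕋 :=
    (integrable_of_continuous_circle (continuous_fourier_div_dispersion_sq hω z)).const_mul _
  have i2 : Integrable (fun k : 𝕋 => ((β * δ : ℝ) : ℂ) * fourier z k) μ𝕋 :=
    (integrable_of_continuous_circle (fourier z).continuous).const_mul _
  have i3 : Integrable (fun k : 𝕋 => (Complex.I * ((β * γ - α * δ : ℝ) : ℂ)) *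
      (fourier z k / (PinnedChainKinetic.dispersion ω₂ k : ℂ))) μ𝕋 :=
    (integrable_of_continuous_circle (continuous_fourier_div_dispersion hω z)).const_mul _
  have i12 : Integrable (fun k : 𝕋 => ((α * γ : ℝ) : ℂ) *
      (fourier z k / (PinnedChainKinetic.dispersion ω₂ k : ℂ) ^ 2) + ((β * δ : ℝ) : ℂ) * fourier z k) μ𝕋 :=
    i1.add i2
  rw [integral_add i12 i3, integral_add i1 i2, integral_const_mul, integral_const_mul,
    integral_const_mul, integral_fourier]
  simp only [Complex.add_re, Complex.mul_re, Complex.ofReal_re, Complex.ofReal_im, zero_mul, sub_zero,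
    Complex.I_re, Complex.I_im, zero_sub, one_mul]
  rw [← greenFn_eq_re_integral hω z, im_integral_fourier_div_dispersion ω₂ z]
  by_cases hz : z = 0
  · simp [hz]
  · simp [hz]

/-! ## The two-point function with a lattice shift -/

/-- The thermal wave as a finite sum over any finite set of sites containing the supports of the
coefficients: `w_f(k) = √(T/2) Σ_{x ∈ S} e_x(k) (f^q_x/ω(k) − i f^p_x)`. [folklore] -/
theorem thermalWave_eq_sum (ω₂ T : ℝ) (f : TestFn) {S : Finset ℤ} (h1 : f.1.support ⊆ S)
    (h2 : f.2.support ⊆ S) (k : 𝕋) :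
    thermalWave ω₂ T f k = (Real.sqrt (T / 2) : ℂ) *
      ∑ x ∈ S, fourier x k * (((f.1 x : ℝ) : ℂ) / (PinnedChainKinetic.dispersion ω₂ k : ℂ) -
        Complex.I * ((f.2 x : ℝ) : ℂ)) := by
  unfold thermalWave
  congr 1
  rw [Finsupp.sum_of_support_subset f.1 h1 _ (fun x _ => by simp),
    Finsupp.sum_of_support_subset f.2 h2 _ (fun x _ => by simp), Finset.mul_sum, ← Finset.sum_sub_distrib]
  refine Finset.sum_congr rfl fun x _ => ?_
  ring

/-- The conjugate thermal wave as a finite sum: `conj w_f(k) = √(T/2) Σ_{x ∈ S} conj e_x(k) (f^q_x/ω(k) + i f^p_x)`.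
[folklore] -/
theorem conj_thermalWave_eq_sum (ω₂ T : ℝ) (f : TestFn) {S : Finset ℤ} (h1 : f.1.support ⊆ S)
    (h2 : f.2.support ⊆ S) (k : 𝕋) :
    conj (thermalWave ω₂ T f k) = (Real.sqrt (T / 2) : ℂ) *
      ∑ x ∈ S, conj (fourier x k) * (((f.1 x : ℝ) : ℂ) / (PinnedChainKinetic.dispersion ω₂ k : ℂ) +
        Complex.I * ((f.2 x : ℝ) : ℂ)) := by
  rw [thermalWave_eq_sum ω₂ T f h1 h2 k, map_mul, Complex.conj_ofReal, map_sum]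
  congr 1
  refine Finset.sum_congr rfl fun x _ => ?_
  rw [map_mul, map_sub, map_mul, map_div₀, Complex.conj_ofReal, Complex.conj_ofReal, Complex.conj_ofReal,
    Complex.conj_I]
  ring

/-- **The thermal two-point function with a lattice shift is a one-phonon Fourier integral.**
For `ω₂ > 0`, `T ≥ 0`, linear observables `φ(f)`, `φ(g)` and `y ∈ ℤ`, with `τ_y g` the coefficient data of
`φ(g) ∘ τ_y` (`(τ_y g)_x = g_{x−y}`):
`C_T(f, τ_y g) = 2 Re ∫_𝕋 e_y(k) conj(w_f(k)) w_g(k) dμ𝕋(k)`. [folklore] -/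
theorem thermalCov_shift_eq_two_mul_re {ω₂ : ℝ} (hω : 0 < ω₂) {T : ℝ} (hT : 0 ≤ T) (f g : TestFn) (y : ℤ) :
    thermalCov ω₂ T f (Finsupp.mapDomain (fun x : ℤ => x + y) g.1, Finsupp.mapDomain (fun x : ℤ => x + y) g.2) =
      2 * (∫ k : 𝕋, fourier y k * (conj (thermalWave ω₂ T f k) * thermalWave ω₂ T g k) ∂μ𝕋).re := by
  classical
  set Sf : Finset ℤ := f.1.support ∪ f.2.support with hSf
  set Sg : Finset ℤ := g.1.support ∪ g.2.support with hSg
  have hf1 : f.1.support ⊆ Sf := Finset.subset_union_left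
  have hf2 : f.2.support ⊆ Sf := Finset.subset_union_right
  have hg1 : g.1.support ⊆ Sg := Finset.subset_union_left
  have hg2 : g.2.support ⊆ Sg := Finset.subset_union_right
  -- the common value
  set V : ℝ := ∑ x ∈ Sf, ∑ x' ∈ Sg,
      (f.1 x * g.1 x' * greenFn ω₂ (x' - x + y) + f.2 x * g.2 x' * (if x' - x + y = 0 then 1 else 0)) with hV
  -- LEFT: the thermal covariance
  have hL : thermalCov ω₂ T f (Finsupp.mapDomain (fun x : ℤ => x + y) g.1,
      Finsupp.mapDomain (fun x : ℤ => x + y) g.2) = T * V := by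
    unfold thermalCov
    congr 1
    -- position part
    have hQ : (f.1.sum fun x a => (Finsupp.mapDomain (fun x : ℤ => x + y) g.1).sum fun x'' b =>
          a * b * greenFn ω₂ (x - x'')) =
        ∑ x ∈ Sf, ∑ x' ∈ Sg, f.1 x * g.1 x' * greenFn ω₂ (x' - x + y) := by
      rw [Finsupp.sum_of_support_subset f.1 hf1 _ (fun x _ => by simp [Finsupp.sum])]
      refine Finset.sum_congr rfl fun x _ => ?_
      rw [Finsupp.sum_mapDomain_index (fun _ => by simp) (fun _ _ _ => by ring),
        Finsupp.sum_of_support_subset g.1 hg1 _ (fun x' _ => by simp)]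
      refine Finset.sum_congr rfl fun x' _ => ?_
      rw [show x - (x' + y) = -(x' - x + y) by ring, greenFn_neg]
    -- momentum part
    have hP : (f.2.sum fun x a => a * (Finsupp.mapDomain (fun x : ℤ => x + y) g.2) x) =
        ∑ x ∈ Sf, ∑ x' ∈ Sg, f.2 x * g.2 x' * (if x' - x + y = 0 then 1 else 0) := by
      rw [Finsupp.sum_of_support_subset f.2 hf2 _ (fun x _ => by simp)]
      refine Finset.sum_congr rfl fun x _ => ?_
      have hmd : (Finsupp.mapDomain (fun x : ℤ => x + y) g.2) x = g.2 (x - y) := by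
        have := Finsupp.mapDomain_apply (add_left_injective y) g.2 (x - y)
        simpa only [sub_add_cancel] using this
      rw [hmd]
      have hsel : ∑ x' ∈ Sg, f.2 x * g.2 x' * (if x' - x + y = 0 then (1 : ℝ) else 0) =
          ∑ x' ∈ Sg, (if x' = x - y then f.2 x * g.2 x' else 0) := by
        refine Finset.sum_congr rfl fun x' _ => ?_
        by_cases h : x' = x - y
        · simp [h]
        · have h' : ¬ (x' - x + y = 0) := fun h'' => h (by linarith)
          simp [h, h']
      rw [hsel, Finset.sum_ite_eq' Sg (x - y)]
      by_cases hx : x - y ∈ Sg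
      · simp [hx]
      · have h0 : g.2 (x - y) = 0 := by
          have : x - y ∉ g.2.support := fun hm => hx (hg2 hm)
          simpa [Finsupp.mem_support_iff] using this
        simp [hx, h0]
    rw [hQ, hP, hV, ← Finset.sum_add_distrib]
    refine Finset.sum_congr rfl fun x _ => ?_
    rw [← Finset.sum_add_distrib]
  -- RIGHT: the one-phonon integral
  set F : ℤ → ℤ → 𝕋 → ℂ := fun x x' k =>
    fourier (x' - x + y) k * ((((f.1 x : ℝ) : ℂ) / (PinnedChainKinetic.dispersion ω₂ k : ℂ) +
      Complex.I * ((f.2 x : ℝ) : ℂ)) * ((((g.1 x' : ℝ) : ℂ)) / (PinnedChainKinetic.dispersion ω₂ k : ℂ) -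
      Complex.I * ((g.2 x' : ℝ) : ℂ))) with hF
  have hR : 2 * (∫ k : 𝕋, fourier y k * (conj (thermalWave ω₂ T f k) * thermalWave ω₂ T g k) ∂μ𝕋).re =
      T * V := by
    have hc2 : ((Real.sqrt (T / 2) : ℂ) * (Real.sqrt (T / 2) : ℂ)) = ((T / 2 : ℝ) : ℂ) := by
      rw [← Complex.ofReal_mul, Real.mul_self_sqrt (by linarith)]
    -- the integrand as a double sum
    have hint : ∀ k : 𝕋, fourier y k * (conj (thermalWave ω₂ T f k) * thermalWave ω₂ T g k) =
        ((T / 2 : ℝ) : ℂ) * ∑ x ∈ Sf, ∑ x' ∈ Sg, F x x' k := by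
      intro k
      rw [conj_thermalWave_eq_sum ω₂ T f hf1 hf2 k, thermalWave_eq_sum ω₂ T g hg1 hg2 k]
      rw [show ∀ (c : ℂ) (A B e : ℂ), e * (c * A * (c * B)) = (c * c) * (e * (A * B)) by intros; ring, hc2]
      congr 1
      rw [Finset.sum_mul_sum, Finset.mul_sum]
      refine Finset.sum_congr rfl fun x _ => ?_
      rw [Finset.mul_sum]
      refine Finset.sum_congr rfl fun x' _ => ?_
      have he : fourier y k * (conj (fourier x k) * fourier x' k) = fourier (x' - x + y) k := by
        rw [conj_fourier, ← fourier_add, ← fourier_add]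
        congr 1
        ring
      rw [hF]
      simp only
      rw [← he]
      ring
    have hterm : ∀ x x' : ℤ, Integrable (F x x') μ𝕋 := by
      intro x x'
      refine integrable_of_continuous_circle ?_
      have hd : Continuous fun k : 𝕋 => (PinnedChainKinetic.dispersion ω₂ k : ℂ) :=
        Complex.continuous_ofReal.comp (PinnedChainKinetic.continuous_dispersion ω₂)
      have hne : ∀ k : 𝕋, (PinnedChainKinetic.dispersion ω₂ k : ℂ) ≠ 0 := fun k =>
        Complex.ofReal_ne_zero.2 (PinnedChainKinetic.dispersion_ne_zero hω k)
      rw [hF]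
      exact (fourier _).continuous.mul (((continuous_const.div hd hne).add continuous_const).mul
        ((continuous_const.div hd hne).sub continuous_const))
    have hpair : ∀ x x' : ℤ, (∫ k, F x x' k ∂μ𝕋).re =
        f.1 x * g.1 x' * greenFn ω₂ (x' - x + y) + f.2 x * g.2 x' * (if x' - x + y = 0 then 1 else 0) := by
      intro x x'
      rw [hF]
      exact re_integral_pair hω (f.1 x) (f.2 x) (g.1 x') (g.2 x') (x' - x + y)
    simp_rw [hint]
    rw [integral_const_mul,
      integral_finsetSum _ (fun x _ => integrable_finsetSum _ (fun x' _ => hterm x x'))]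
    simp_rw [integral_finsetSum _ (fun x' _ => hterm _ x')]
    rw [Complex.re_ofReal_mul, Complex.re_sum]
    simp_rw [Complex.re_sum, hpair]
    rw [hV]
    ring
  rw [hL, hR]

end Summit.AtomisticToContinuum.FouriersLaw.Theorems.DrudeDissolution.GramPencilHarmonicChaos

end
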